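import Summits.CriticalPhenomena.PercolationContinuityZ3.Theorems.PercNearOneGluingNoHeavyLowerTailThreePointHalvingResample
import HarnessLib

/-!
# The halving lemma (v): the CANONICAL-SPLIT IDENTITY `μ(a ↔ s, c ∉ C_s) = Σ_{η ∈ s|a|c} w_{off}(η) · λ_a(C_s(η))`
# (Sahi programme, prover prim-sahi-p2 gen 47)

Support file (`--supports stmt-CriticalPhenomena-4575`, helper).  No definitions, no named facts, no sorries; standard axioms.
Memo `run/shared/lean/prim/prim-sahi/FROM-prim-sahi-p2-gen47-RESAMPLING.md` §2e; `prim-sahi-p2/PROOF-E3.md` §57 (57c).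

SETTING.  Finite vertex type `V`, Gladkov's Bernoulli weights `DecisionTree.wtW` on configurations `K ⊆ Sym2 V` (all pairs are
coordinates, as in `…ThreePointHalvingResample`), three vertices `s, a, c` with `s ≠ a`.  Types: P1 = `{a ↔ s, s ↮ c}` (then also
`a ↮ c`), S₀ = `s|a|c` = `{a ↮ s, a ↮ c, s ↮ c}`.  For a configuration `ζ` let `A°(ζ)` be the open cluster of `s` after deleting the
pairs at `a` and `E_a(ζ) := {s(a,x) : x ∈ A°(ζ)}` (the pairs from `a` into it); for `η ∈ S₀`, `A°(η) = C_s(η)`.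

WHAT IS PROVED (every weight vector `p`, every `s ≠ a`, `c`).
* `starFree_eq` / `Ea_congr` — `E_a(ζ)` depends only on `ζ` off the pairs at `a`.
* `notMem_of_S0` — for `η ∈ S₀` no pair of `E_a(η)` is open in `η`.
* `union_mem_P1` — for `η ∈ S₀` and `∅ ≠ F ⊆ E_a(η)`: `η ∪ F ∈ P1`.
* `sdiff_mem_S0`, `inter_nonempty_of_P1` — for `ξ ∈ P1`: `ξ ∖ E_a(ξ) ∈ S₀` and `ξ ∩ E_a(ξ) ≠ ∅` (the CANONICAL SPLIT of `ξ`: `A° = C_s(ξ − a)`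
  is the maximal `s`-side, its open cut is the set of open pairs AT `a`).
* **`sum_P1_eq_sum_S0_layer`** — the identity
  `Σ_ξ wtW ξ · 1_{P1}(ξ) = Σ_η 1_{S₀}(η) · wtW_{off E_a(η)}(η) · (1 − Π_{e ∈ E_a(η)} (1 − p_e))`,
  i.e. `p₁ = E[1_{s|a|c} · λ_a(C_s)/(1 − λ_a(C_s))]` whenever the pairs at `a` have weights `< 1` (`λ_a(A)` = probability that `a` has
  an open pair into `A`).  Proof: expand `1 − Π(1−p)` over nonempty `F ⊆ E_a(η)` (`Finset.prod_add`), factor the weight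
  (`wtW_union_eq`), and re-index by the bijection `(η, F) ↦ η ∪ F`, `ξ ↦ (ξ ∖ E_a(ξ), ξ ∩ E_a(ξ))` between `{(η ∈ S₀, ∅ ≠ F ⊆ E_a(η))}`
  and P1.  With `…ThreePointHalvingResample` this makes the halving lemma (v) an inequality between two explicit functionals of ONE
  `s|a|c` configuration (memo §0(9)): by the same identity with `c` in place of `s`, `μ(U ∩ D) = p₁ + p₂ = E[1_{S₀}(odds_a(C_s) + odds_a(C_c))]`.
-/

noncomputable section

open Classical

namespace Summit.CriticalPhenomena.PercolationContinuityZ3.Theorems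

namespace HalvingResample

open Finset
open Literature.Probability.Percolation Literature.Probability.Percolation.DecisionTree

variable {V : Type*} [Fintype V]

/-! ### The pairs at `a`, the `a`-free cluster of `s`, and the canonical cut `E_a` -/

/-- `E_a(ζ)` depends only on `ζ` off the pairs at `a`: if `ζ` and `ζ'` agree off the pairs containing `a` then their `a`-free
`s`-clusters, hence their canonical cuts, coincide. [this work] -/
theorem Ea_congr (s a : V) {ζ ζ' : Finset (Sym2 V)}
    (h : ζ \ Finset.univ.filter (fun e : Sym2 V => a ∈ e) = ζ' \ Finset.univ.filter (fun e : Sym2 V => a ∈ e)) :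
    Finset.univ.filter (fun e : Sym2 V => ∃ x : V, e = s(a, x) ∧
        (openGraph (↑(ζ \ Finset.univ.filter (fun e : Sym2 V => a ∈ e)) : Set (Sym2 V))).Reachable s x) =
      Finset.univ.filter (fun e : Sym2 V => ∃ x : V, e = s(a, x) ∧
        (openGraph (↑(ζ' \ Finset.univ.filter (fun e : Sym2 V => a ∈ e)) : Set (Sym2 V))).Reachable s x) := by
  rw [h]

omit [Fintype V] in
/-- In a configuration without pairs at `a`, the vertex `a ≠ s` is not joined to `s`. [folklore] -/
theorem not_reachable_of_starFree {s a : V} (hsa : s ≠ a) {θ : Finset (Sym2 V)} (hθ : ∀ e ∈ θ, a ∉ e) :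
    ¬ (openGraph (↑θ : Set (Sym2 V))).Reachable s a := by
  rintro ⟨p⟩
  -- a walk from `s` to `a` has a dart entering `a`: its pair contains `a`
  obtain ⟨d, -, -, hd2⟩ := p.exists_boundary_dart {v : V | v ≠ a} hsa (fun h => h rfl)
  have h2 : d.toProd.2 = a := by
    by_contra h
    exact hd2 h
  have hadj := d.adj
  rw [openGraph_adj, h2] at hadj
  exact hθ _ (Finset.mem_coe.1 hadj.1) (Sym2.mem_mk_right _ _)

/-! ### From `s|a|c` up: opening pairs of the canonical cut -/

/-- For `η ∈ S₀` (here only `a ↮ s` is used) no pair of `E_a(η)` is open in `η`: an open pair `s(a,x)` with `x` in the `a`-free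
cluster of `s` would join `a` to `s`. [this work] -/
theorem notMem_of_notReach {s a : V} {η : Finset (Sym2 V)}
    (has : ¬ (openGraph (↑η : Set (Sym2 V))).Reachable a s) {e : Sym2 V}
    (he : e ∈ Finset.univ.filter (fun e : Sym2 V => ∃ x : V, e = s(a, x) ∧
        (openGraph (↑(η \ Finset.univ.filter (fun e : Sym2 V => a ∈ e)) : Set (Sym2 V))).Reachable s x)) :
    e ∉ η := by
  intro heη
  rw [Finset.mem_filter] at he
  obtain ⟨-, x, rfl, hx⟩ := he
  have hx' : (openGraph (↑η : Set (Sym2 V))).Reachable s x :=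
    hx.mono (openGraph_mono (Finset.coe_subset.2 Finset.sdiff_subset))
  by_cases hax : a = x
  · subst hax; exact has hx'.symm
  · have hadj : (openGraph (↑η : Set (Sym2 V))).Adj a x := by
      rw [openGraph_adj]; exact ⟨Finset.mem_coe.2 heη, hax⟩
    exact has (hadj.reachable.trans hx'.symm)

/-- For `η ∈ S₀` and `F ⊆ E_a(η)`, every vertex joined to `s` in `η ∪ F` is joined to `s` or to `a` in `η` (the set
`C_s(η) ∪ C_a(η)` is closed under the adjacency of `η ∪ F`). [this work] -/
theorem reach_union_subset {s a : V} {η F : Finset (Sym2 V)}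
    (hF : F ⊆ Finset.univ.filter (fun e : Sym2 V => ∃ x : V, e = s(a, x) ∧
        (openGraph (↑(η \ Finset.univ.filter (fun e : Sym2 V => a ∈ e)) : Set (Sym2 V))).Reachable s x))
    {v : V} (hv : (openGraph (↑(η ∪ F) : Set (Sym2 V))).Reachable s v) :
    (openGraph (↑η : Set (Sym2 V))).Reachable s v ∨ (openGraph (↑η : Set (Sym2 V))).Reachable a v := by
  -- induct along a walk, with the invariant `s ↔ x ∨ a ↔ x` in `η`
  suffices h : ∀ (x : V) (q : (openGraph (↑(η ∪ F) : Set (Sym2 V))).Walk x v),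
      ((openGraph (↑η : Set (Sym2 V))).Reachable s x ∨ (openGraph (↑η : Set (Sym2 V))).Reachable a x) →
      ((openGraph (↑η : Set (Sym2 V))).Reachable s v ∨ (openGraph (↑η : Set (Sym2 V))).Reachable a v) from
    hv.elim fun q => h s q (Or.inl (SimpleGraph.Reachable.refl s))
  clear hv
  intro x q
  induction q with
  | nil => exact id
  | @cons x y z hadj q ih =>
    intro hx
    apply ih
    have hadj' := hadj
    rw [openGraph_adj] at hadj'
    obtain ⟨hmem, hne⟩ := hadj'
    rcases Finset.mem_union.1 (Finset.mem_coe.1 hmem) with hη | hFm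
    · -- an `η`-pair keeps each of the two clusters
      have hadjη : (openGraph (↑η : Set (Sym2 V))).Adj x y := by rw [openGraph_adj]; exact ⟨Finset.mem_coe.2 hη, hne⟩
      rcases hx with h | h
      · exact Or.inl (h.trans hadjη.reachable)
      · exact Or.inr (h.trans hadjη.reachable)
    · -- an `F`-pair is `s(a, x')` with `x'` in the `a`-free cluster of `s`
      have hFe := Finset.mem_filter.1 (hF hFm)
      obtain ⟨-, x', hx'e, hx'⟩ := hFe
      have hx'' : (openGraph (↑η : Set (Sym2 V))).Reachable s x' :=
        hx'.mono (openGraph_mono (Finset.coe_subset.2 Finset.sdiff_subset))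
      have hy : y = a ∨ y = x' := by
        have : y ∈ s(a, x') := by rw [← hx'e]; exact Sym2.mem_mk_right _ _
        exact Sym2.mem_iff.1 this
      rcases hy with rfl | rfl
      · exact Or.inr (SimpleGraph.Reachable.refl _)
      · exact Or.inl hx''

/-! ### From P1 down: the canonical split -/

/-- For `ξ` with `a ↔ s` (`s ≠ a`): the configuration `ξ ∖ E_a(ξ)` has `a ↮ s` — the `a`-free cluster `A°` of `s` is left
only through pairs at `a` into `A°`, which are exactly `E_a(ξ)`. [this work] -/
theorem notReach_sdiff {s a : V} (hsa : s ≠ a) (ξ : Finset (Sym2 V)) :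
    ¬ (openGraph (↑(ξ \ Finset.univ.filter (fun e : Sym2 V => ∃ x : V, e = s(a, x) ∧
        (openGraph (↑(ξ \ Finset.univ.filter (fun e : Sym2 V => a ∈ e)) : Set (Sym2 V))).Reachable s x)) :
          Set (Sym2 V))).Reachable s a := by
  set star : Finset (Sym2 V) := Finset.univ.filter (fun e : Sym2 V => a ∈ e) with hstar
  set Ea : Finset (Sym2 V) := Finset.univ.filter (fun e : Sym2 V => ∃ x : V, e = s(a, x) ∧
      (openGraph (↑(ξ \ star) : Set (Sym2 V))).Reachable s x) with hEa
  set T : Set V := {v | (openGraph (↑(ξ \ star) : Set (Sym2 V))).Reachable s v} with hT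
  have hsT : s ∈ T := SimpleGraph.Reachable.refl s
  have haT : a ∉ T := not_reachable_of_starFree hsa (fun e he hae => by
    rw [Finset.mem_sdiff] at he
    exact he.2 (Finset.mem_filter.2 ⟨Finset.mem_univ _, hae⟩))
  rintro ⟨p⟩
  obtain ⟨d, -, hd1, hd2⟩ := p.exists_boundary_dart T hsT haT
  have hadj := d.adj
  rw [openGraph_adj] at hadj
  obtain ⟨hmem, hne⟩ := hadj
  have hmem' := Finset.mem_sdiff.1 (Finset.mem_coe.1 hmem)
  by_cases hst : s(d.toProd.1, d.toProd.2) ∈ star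
  · -- a pair at `a` leaving `T`: it is `s(a, u)` with `u = d.fst ∈ T`, hence in `E_a(ξ)` — but those were removed
    have ha : a ∈ s(d.toProd.1, d.toProd.2) := (Finset.mem_filter.1 hst).2
    rcases Sym2.mem_iff.1 ha with ha1 | ha2
    · exact haT (ha1 ▸ hd1)
    · apply hmem'.2
      exact Finset.mem_filter.2 ⟨Finset.mem_univ _, d.toProd.1, Sym2.eq_iff.2 (Or.inr ⟨rfl, ha2.symm⟩), hd1⟩
  · -- a pair off `a` inside `ξ`: it keeps `T`
    have hadj' : (openGraph (↑(ξ \ star) : Set (Sym2 V))).Adj d.toProd.1 d.toProd.2 := by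
      rw [openGraph_adj]; exact ⟨Finset.mem_coe.2 (Finset.mem_sdiff.2 ⟨hmem'.1, hst⟩), hne⟩
    exact hd2 (hd1.trans hadj'.reachable)

/-- For `ξ` with `a ↔ s` (`s ≠ a`): some pair of `E_a(ξ)` is open in `ξ` (an `s–a` walk leaves the `a`-free cluster of `s`
through a pair at `a`). [this work] -/
theorem inter_nonempty_of_reach {s a : V} (hsa : s ≠ a) {ξ : Finset (Sym2 V)}
    (h : (openGraph (↑ξ : Set (Sym2 V))).Reachable s a) :
    (ξ ∩ Finset.univ.filter (fun e : Sym2 V => ∃ x : V, e = s(a, x) ∧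
        (openGraph (↑(ξ \ Finset.univ.filter (fun e : Sym2 V => a ∈ e)) : Set (Sym2 V))).Reachable s x)).Nonempty := by
  set star : Finset (Sym2 V) := Finset.univ.filter (fun e : Sym2 V => a ∈ e) with hstar
  set T : Set V := {v | (openGraph (↑(ξ \ star) : Set (Sym2 V))).Reachable s v} with hT
  have hsT : s ∈ T := SimpleGraph.Reachable.refl s
  have haT : a ∉ T := not_reachable_of_starFree hsa (fun e he hae => by
    rw [Finset.mem_sdiff] at he
    exact he.2 (Finset.mem_filter.2 ⟨Finset.mem_univ _, hae⟩))
  obtain ⟨p⟩ := h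
  obtain ⟨d, -, hd1, hd2⟩ := p.exists_boundary_dart T hsT haT
  have hadj := d.adj
  rw [openGraph_adj] at hadj
  obtain ⟨hmem, hne⟩ := hadj
  have hmemξ : s(d.toProd.1, d.toProd.2) ∈ ξ := Finset.mem_coe.1 hmem
  by_cases hst : s(d.toProd.1, d.toProd.2) ∈ star
  · have ha : a ∈ s(d.toProd.1, d.toProd.2) := (Finset.mem_filter.1 hst).2
    rcases Sym2.mem_iff.1 ha with ha1 | ha2
    · exact absurd (ha1 ▸ hd1) haT
    · exact ⟨s(d.toProd.1, d.toProd.2), Finset.mem_inter.2 ⟨hmemξ,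
        Finset.mem_filter.2 ⟨Finset.mem_univ _, d.toProd.1, Sym2.eq_iff.2 (Or.inr ⟨rfl, ha2.symm⟩), hd1⟩⟩⟩
  · have hadj' : (openGraph (↑(ξ \ star) : Set (Sym2 V))).Adj d.toProd.1 d.toProd.2 := by
      rw [openGraph_adj]; exact ⟨Finset.mem_coe.2 (Finset.mem_sdiff.2 ⟨hmemξ, hst⟩), hne⟩
    exact absurd (hd1.trans hadj'.reachable) hd2

/-! ### Weights -/

/-- Weight factorisation: if `K` misses `E` and `F ⊆ E`, then
`wtW univ (K ∪ F) = wtW (univ ∖ E) K · (Π_{e∈F} p_e · Π_{e ∈ E ∖ F} (1 − p_e))`. [folklore] -/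
theorem wtW_union_eq (p : Sym2 V → ℝ) {K E F : Finset (Sym2 V)} (hKE : Disjoint K E) (hFE : F ⊆ E) :
    wtW Finset.univ p (K ∪ F) = wtW (Finset.univ \ E) p K * ((∏ e ∈ F, p e) * ∏ e ∈ E \ F, (1 - p e)) := by
  unfold wtW
  rw [← Finset.prod_sdiff (Finset.subset_univ E)]
  congr 1
  · refine Finset.prod_congr rfl fun e he => ?_
    have heE : e ∉ E := (Finset.mem_sdiff.1 he).2
    have : e ∈ K ∪ F ↔ e ∈ K := by
      rw [Finset.mem_union]
      exact ⟨fun h => h.elim id fun hF => absurd (hFE hF) heE, Or.inl⟩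
    simp only [this]
  · rw [← Finset.prod_sdiff hFE, mul_comm]
    congr 1
    · refine Finset.prod_congr rfl fun e he => ?_
      rw [if_pos (Finset.mem_union_right _ he)]
    · refine Finset.prod_congr rfl fun e he => ?_
      have heF : e ∉ F := (Finset.mem_sdiff.1 he).2
      have heK : e ∉ K := fun h => Finset.disjoint_left.1 hKE h (Finset.mem_sdiff.1 he).1
      rw [if_neg (fun h => (Finset.mem_union.1 h).elim heK heF)]

omit [Fintype V] in
/-- `1 − Π_{e∈E}(1 − p_e) = Σ_{∅ ≠ F ⊆ E} Π_{F} p · Π_{E∖F} (1 − p)`. [folklore] -/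
theorem one_sub_prod_eq_sum (p : Sym2 V → ℝ) (E : Finset (Sym2 V)) :
    1 - ∏ e ∈ E, (1 - p e) = ∑ F ∈ E.powerset.filter (fun F => F.Nonempty), (∏ e ∈ F, p e) * ∏ e ∈ E \ F, (1 - p e) := by
  have h := Finset.prod_add (fun e => p e) (fun e => 1 - p e) E
  have h1 : ∏ e ∈ E, (p e + (1 - p e)) = 1 := Finset.prod_eq_one fun e _ => by ring
  rw [h1, ← Finset.sum_filter_add_sum_filter_not E.powerset (fun F => F.Nonempty)] at h
  have h0 : ∑ F ∈ E.powerset.filter (fun F => ¬ F.Nonempty), (∏ e ∈ F, p e) * ∏ e ∈ E \ F, (1 - p e) =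
      ∏ e ∈ E, (1 - p e) := by
    have hfil : E.powerset.filter (fun F => ¬ F.Nonempty) = {∅} := by
      ext F
      simp only [Finset.mem_filter, Finset.mem_powerset, Finset.not_nonempty_iff_eq_empty, Finset.mem_singleton]
      exact ⟨fun h => h.2, fun h => ⟨h ▸ Finset.empty_subset E, h⟩⟩
    rw [hfil, Finset.sum_singleton, Finset.prod_empty, one_mul, Finset.sdiff_empty]
  linarith

/-! ### The identity -/

/-- **Canonical-split identity.**  With `E_a(ζ) = {s(a,x) : x ∈ C_s(ζ − pairs at a)}`:
`Σ_ξ wtW ξ · 1[a ↔ s, s ↮ c](ξ) = Σ_η 1[a ↮ s, a ↮ c, s ↮ c](η) · wtW_{univ ∖ E_a(η)}(η) · (1 − Π_{e ∈ E_a(η)} (1 − p_e))`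
— every configuration of P1 arises exactly once as `η ∪ F` with `η ∈ S₀` and `∅ ≠ F ⊆ E_a(η)` (its canonical split: the `a`-free
cluster of `s` is the maximal `s`-side, the open cut consists of the open pairs at `a`).  When every pair at `a` has weight `< 1`
the right side is `E[1_{s|a|c} · λ_a(C_s)/(1 − λ_a(C_s))]`, `λ_a(A) = 1 − Π_{x∈A}(1 − p_{ax})`. [this work] -/
theorem sum_P1_eq_sum_S0_layer (p : Sym2 V → ℝ) {s a : V} (hsa : s ≠ a) (c : V) :
    ∑ ξ ∈ (Finset.univ : Finset (Sym2 V)).powerset, wtW Finset.univ p ξ *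
        ind {ξ : Finset (Sym2 V) | (openGraph (↑ξ : Set (Sym2 V))).Reachable a s ∧
          ¬ (openGraph (↑ξ : Set (Sym2 V))).Reachable s c} ξ =
    ∑ η ∈ (Finset.univ : Finset (Sym2 V)).powerset,
      ind {η : Finset (Sym2 V) | ¬ (openGraph (↑η : Set (Sym2 V))).Reachable a s ∧
          ¬ (openGraph (↑η : Set (Sym2 V))).Reachable a c ∧ ¬ (openGraph (↑η : Set (Sym2 V))).Reachable s c} η *
      (wtW (Finset.univ \ Finset.univ.filter (fun e : Sym2 V => ∃ x : V, e = s(a, x) ∧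
            (openGraph (↑(η \ Finset.univ.filter (fun e : Sym2 V => a ∈ e)) : Set (Sym2 V))).Reachable s x)) p η *
        (1 - ∏ e ∈ Finset.univ.filter (fun e : Sym2 V => ∃ x : V, e = s(a, x) ∧
            (openGraph (↑(η \ Finset.univ.filter (fun e : Sym2 V => a ∈ e)) : Set (Sym2 V))).Reachable s x), (1 - p e))) := by
  set D : Finset (Sym2 V) := Finset.univ with hD
  set star : Finset (Sym2 V) := Finset.univ.filter (fun e : Sym2 V => a ∈ e) with hstar
  -- the canonical cut as a function of the configuration
  set Ea : Finset (Sym2 V) → Finset (Sym2 V) := fun ζ => Finset.univ.filter (fun e : Sym2 V => ∃ x : V, e = s(a, x) ∧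
      (openGraph (↑(ζ \ star) : Set (Sym2 V))).Reachable s x) with hEa
  set P1 : Set (Finset (Sym2 V)) := {ξ | (openGraph (↑ξ : Set (Sym2 V))).Reachable a s ∧
      ¬ (openGraph (↑ξ : Set (Sym2 V))).Reachable s c} with hP1
  set S0 : Set (Finset (Sym2 V)) := {η | ¬ (openGraph (↑η : Set (Sym2 V))).Reachable a s ∧
      ¬ (openGraph (↑η : Set (Sym2 V))).Reachable a c ∧ ¬ (openGraph (↑η : Set (Sym2 V))).Reachable s c} with hS0
  -- basic facts about `Ea`
  have hEa_star : ∀ ζ, Ea ζ ⊆ star := by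
    intro ζ e he
    obtain ⟨-, x, rfl, -⟩ := Finset.mem_filter.1 he
    exact Finset.mem_filter.2 ⟨Finset.mem_univ _, Sym2.mem_mk_left _ _⟩
  have hEa_congr : ∀ ζ ζ' : Finset (Sym2 V), ζ \ star = ζ' \ star → Ea ζ = Ea ζ' := fun ζ ζ' h => by
    simp only [hEa]; rw [h]
  have hEa_union : ∀ (η F : Finset (Sym2 V)), F ⊆ Ea η → Ea (η ∪ F) = Ea η := by
    intro η F hF
    apply hEa_congr
    ext e
    simp only [Finset.mem_sdiff, Finset.mem_union]
    constructor
    · rintro ⟨h | h, hs⟩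
      · exact ⟨h, hs⟩
      · exact absurd (hEa_star η (hF h)) hs
    · rintro ⟨h, hs⟩; exact ⟨Or.inl h, hs⟩
  have hEa_sdiff : ∀ ξ : Finset (Sym2 V), Ea (ξ \ Ea ξ) = Ea ξ := by
    intro ξ
    apply hEa_congr
    ext e
    simp only [Finset.mem_sdiff]
    constructor
    · rintro ⟨⟨h, -⟩, hs⟩; exact ⟨h, hs⟩
    · rintro ⟨h, hs⟩; exact ⟨⟨h, fun hE => hs (hEa_star ξ hE)⟩, hs⟩
  -- LHS as a filtered sum; RHS as a double sum over (η, F)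
  have hL : ∑ ξ ∈ D.powerset, wtW D p ξ * ind P1 ξ = ∑ ξ ∈ D.powerset.filter (fun ξ => ξ ∈ P1), wtW D p ξ := by
    rw [Finset.sum_filter]
    refine Finset.sum_congr rfl fun ξ _ => ?_
    by_cases h : ξ ∈ P1
    · rw [if_pos h, ind_of_mem h, mul_one]
    · rw [if_neg h, ind_of_not_mem h, mul_zero]
  have hR : ∑ η ∈ D.powerset, ind S0 η * (wtW (D \ Ea η) p η * (1 - ∏ e ∈ Ea η, (1 - p e))) =
      ∑ η ∈ D.powerset.filter (fun η => η ∈ S0), ∑ F ∈ (Ea η).powerset.filter (fun F => F.Nonempty), wtW D p (η ∪ F) := by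
    rw [Finset.sum_filter]
    refine Finset.sum_congr rfl fun η _ => ?_
    by_cases hη : η ∈ S0
    · rw [if_pos hη, ind_of_mem hη, one_mul, one_sub_prod_eq_sum, Finset.mul_sum]
      refine Finset.sum_congr rfl fun F hF => ?_
      have hFE : F ⊆ Ea η := Finset.mem_powerset.1 (Finset.mem_filter.1 hF).1
      have hdis : Disjoint η (Ea η) := Finset.disjoint_left.2 fun e heη heE => notMem_of_notReach hη.1 heE heη
      rw [wtW_union_eq p hdis hFE]
    · rw [if_neg hη, ind_of_not_mem hη, zero_mul]
  rw [hL, hR, Finset.sum_sigma']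
  symm
  -- the bijection `(η, F) ↦ η ∪ F`
  refine Finset.sum_bij' (fun x _ => x.1 ∪ x.2) (fun ξ _ => ⟨ξ \ Ea ξ, ξ ∩ Ea ξ⟩) ?_ ?_ ?_ ?_ ?_
  · -- into P1
    rintro ⟨η, F⟩ hx
    simp only [Finset.mem_sigma, Finset.mem_filter, Finset.mem_powerset] at hx
    obtain ⟨⟨-, hη⟩, hFE, hFne⟩ := hx
    rw [Finset.mem_filter, Finset.mem_powerset]
    refine ⟨Finset.subset_univ _, ?_, ?_⟩
    · -- `a ↔ s`: an open pair `s(a,x)` with `x` in the `a`-free cluster of `s`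
      obtain ⟨e, he⟩ := hFne
      obtain ⟨-, x, rfl, hx⟩ := Finset.mem_filter.1 (hFE he)
      have hx' : (openGraph (↑(η ∪ F) : Set (Sym2 V))).Reachable s x :=
        hx.mono (openGraph_mono (by
          intro e he'
          exact Finset.mem_coe.2 (Finset.mem_union_left _ (Finset.mem_sdiff.1 (Finset.mem_coe.1 he')).1)))
      have hxa : x ≠ a := by
        rintro rfl
        exact not_reachable_of_starFree hsa (θ := η \ star) (fun e he hae => (Finset.mem_sdiff.1 he).2
          (Finset.mem_filter.2 ⟨Finset.mem_univ _, hae⟩)) hx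
      have hadj : (openGraph (↑(η ∪ F) : Set (Sym2 V))).Adj a x := by
        rw [openGraph_adj]; exact ⟨Finset.mem_coe.2 (Finset.mem_union_right _ he), hxa.symm⟩
      exact hadj.reachable.trans hx'.symm
    · -- `s ↮ c`
      intro hsc
      rcases reach_union_subset hFE hsc with h | h
      · exact hη.2.2 h
      · exact hη.2.1 h
  · -- into the sigma set
    intro ξ hξ
    rw [Finset.mem_filter] at hξ
    obtain ⟨-, hξ⟩ := hξ
    simp only [Finset.mem_sigma, Finset.mem_filter, Finset.mem_powerset]
    refine ⟨⟨Finset.subset_univ _, ?_, ?_, ?_⟩, ?_, ?_⟩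
    · -- `a ↮ s` in `ξ ∖ Ea ξ`
      intro h
      exact notReach_sdiff hsa ξ h.symm
    · intro h
      have h' : (openGraph (↑ξ : Set (Sym2 V))).Reachable a c := h.mono (openGraph_mono (Finset.coe_subset.2 Finset.sdiff_subset))
      exact hξ.2 (hξ.1.symm.trans h')
    · intro h
      exact hξ.2 (h.mono (openGraph_mono (Finset.coe_subset.2 Finset.sdiff_subset)))
    · rw [hEa_sdiff]; exact Finset.inter_subset_right
    · exact inter_nonempty_of_reach hsa hξ.1.symm
  · -- left inverse
    rintro ⟨η, F⟩ hx
    simp only [Finset.mem_sigma, Finset.mem_filter, Finset.mem_powerset] at hx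
    obtain ⟨⟨-, hη⟩, hFE, -⟩ := hx
    have hdis : Disjoint η (Ea η) := Finset.disjoint_left.2 fun e heη heE => notMem_of_notReach hη.1 heE heη
    have hE : Ea (η ∪ F) = Ea η := hEa_union η F hFE
    have h1 : (η ∪ F) \ Ea (η ∪ F) = η := by
      rw [hE, Finset.union_sdiff_distrib, Finset.sdiff_eq_self_of_disjoint hdis, Finset.sdiff_eq_empty_iff_subset.2 hFE,
        Finset.union_empty]
    have h2 : (η ∪ F) ∩ Ea (η ∪ F) = F := by
      rw [hE, Finset.union_inter_distrib_right, Finset.disjoint_iff_inter_eq_empty.1 hdis, Finset.empty_union,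
        Finset.inter_eq_left.2 hFE]
    exact Sigma.ext h1 (heq_of_eq h2)
  · -- right inverse
    intro ξ _
    exact Finset.sdiff_union_inter ξ (Ea ξ)
  · -- summands agree
    intro x _
    rfl

end HalvingResample

end Summit.CriticalPhenomena.PercolationContinuityZ3.Theorems
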